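import Mathlib
import Summits.Ventures.PercRepro2.Defs
import Summits.Ventures.PercRepro2.Independence
import Summits.Ventures.PercRepro2.Harris
import Summits.Ventures.PercRepro2.Graph
import Summits.Ventures.PercRepro2.Exploration
import Summits.Ventures.PercRepro2.Events
import Summits.Ventures.PercRepro2.FourFunctions
import Summits.Ventures.PercRepro2.Induced
import Summits.Ventures.PercRepro2.Frontier
import Summits.Ventures.PercRepro2.ObsIndependence
import Summits.Ventures.PercRepro2.BHK
import Summits.Ventures.PercRepro2.BHKEvents
import Summits.Ventures.PercRepro2.VdBKahn
import Summits.Ventures.PercRepro2.BHKAvoid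
import Summits.Ventures.PercRepro2.MultiSource
import Summits.Ventures.PercRepro2.SeedSet
import Summits.Ventures.PercRepro2.MultiSourceFun
import Summits.Ventures.PercRepro2.YBridge
import Summits.Ventures.PercRepro2.Yu1Functionals
import Summits.Ventures.PercRepro2.ZDelta
import Summits.Ventures.PercRepro2.ZExpand
import Summits.Ventures.PercRepro2.RGapShare
import Summits.Ventures.PercRepro2.ZhTwoCopy
import Summits.Ventures.PercRepro2.ExplorationTree

/-!
# T-explorations and the per-leaf quantities of the sub-lemma SL1 (blind cell PercRepro2, typer-1;
p1 g5 `proofs/P1-L1TWOCOPY.md` §6, ask 2026-08-23T03:30:16Z)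

A **T-exploration** (`TExploration ends a₁ a₂ a₃`) is a valid exploration tree (`ExplorationTree`)
with a T-leaf predicate and, for every T-leaf `ℓ`, an explored seed set `S_ℓ` such that
* on a T-leaf, `T = {a₁ ∉ C₂, a₃ ∈ C₂}` coincides with `Q = {a₁ ∉ C₂}` (the explored open path
  `a₃ → a₂` is already seen) and the heavy cluster is the union cluster of `S_ℓ`
  (`ClusterDetermined`: the residual growth of `C₂` only uses unexplored edges);
* a non-T-leaf misses `T` entirely (`a₁` joined the explored cluster first, or the exploration
  exhausted `C(a₃)` without meeting `a₂`).
The canonical exploration from `a₃` (first unexplored edge touching the explored cluster, fixed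
edge order, stop when `a₂` joins, fail when `a₁` joins) is such an object; its construction is a
separate file — everything here holds for EVERY `TExploration`.

* **`expect_leaves_sum`** / `expect_leaves_sum_root`: the leaf partition for expectations,
  `Σ_{ℰ ∈ leaves t P} E[f · 1_ℰ] = E[f · 1_{P.event}]`;
* `avoidAllT_iff_of_determined`: on a leaf with `ClusterDetermined ℓ a₂ S`, `{S ↮ a₁} = Q`;
* **`expect_T_eq_sum`**: `E[f · 1_T] = Σ_{T-leaves} P(ℓ) · E[f · 1_Q ∣ ℓ]` (leaf decomposition of `T`,
  with `E[· ∣ ℓ] = expect (pin p ℓ)`).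

With `D = P(PD)`, `D_o = P(PD, o ∈ C₁ ∪ C₂)`, `U = C₂`, `f_x(U) = P_{G∖U}(x ∈ C₁)`:
* `Phi ω := (D_o − D f_o(U)) (1_{b ∈ U} − f_b(U))` — `D` times p1's `φ χ`;
* per-leaf quantities `leafA ℓ := E[(D_o − D f_o(U)) 1_Q ∣ ℓ]` (`D` times p1's `A(ℓ)`),
  `leafB ℓ := E[(1_{b ∈ U} − f_b(U)) 1_Q ∣ ℓ]` (p1's `B(ℓ)`), `leafQ ℓ := P(Q ∣ ℓ)`, and
  **`SL1 τ := Σ_{T-leaves} P(ℓ) · leafA ℓ · leafB ℓ / leafQ ℓ`** (`D` times p1's `SL1`; a term with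
  `P(Q ∣ ℓ) = 0` is `0`).
The theorems `C1_slack_eq`, `leaf_PA`, `SL1_le_C1_slack`, `ZhTwoCopy_of_SL1` are in
`ExplorationSL1.lean`.
-/

namespace Summit.Ventures.PercRepro2

open UnionCluster Yu1

namespace ExplorationTree

/-! ## List helpers -/

section Lists

variable {α : Type*} {R : Type*}

/-- Sums over a filtered list as sums over the list with the filtered-out terms zeroed. -/
lemma sum_map_filter_eq [AddCommMonoid R] (l : List α) (q : α → Bool) (f : α → R) :
    ((l.filter q).map f).sum = (l.map fun a => if q a = true then f a else 0).sum := by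
  induction l with
  | nil => simp
  | cons a l ih =>
    rw [List.filter_cons]
    by_cases h : q a = true
    · simp [h, ih]
    · simp [h, ih]

/-- Termwise comparison of sums over a list. -/
lemma sum_map_le_sum_map [AddCommMonoid R] [PartialOrder R] [IsOrderedAddMonoid R] (l : List α)
    (f g : α → R)
    (h : ∀ a ∈ l, f a ≤ g a) : (l.map f).sum ≤ (l.map g).sum := by
  induction l with
  | nil => simp
  | cons a l ih =>
    simp only [List.map_cons, List.sum_cons]
    exact add_le_add (h a (List.mem_cons_self ..)) (ih fun a' ha' => h a' (List.mem_cons_of_mem a ha'))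

end Lists

/-! ## The leaf partition for expectations -/

section ExpectPartition

variable {E : Type*} [Fintype E] [DecidableEq E] {R : Type*} [CommRing R]

omit [Fintype E] [DecidableEq E] in
/-- `1_{closed e} + 1_{open e} = 1`. -/
lemma closed_add_open_indicator (e : E) (ω : Config E) :
    (closedEdge e).indicator (1 : Config E → R) ω + (openEdge e).indicator 1 ω = 1 := by
  by_cases h : ω e = true
  · have h1 : ω ∈ openEdge e := h
    have h2 : ω ∉ closedEdge e := by
      show ¬ ω e = false
      simp [h]
    simp [h1, h2]
  · have h1 : ω ∉ openEdge e := h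
    have h2 : ω ∈ closedEdge e := by
      show ω e = false
      simpa using h
    simp [h1, h2]

/-- **The leaves of a valid tree partition expectations**:
`Σ_{ℰ ∈ leaves t P} E[f · 1_ℰ] = E[f · 1_{P.event}]`. -/
theorem expect_leaves_sum (p : E → R) (t : ETree E) :
    ∀ (P : Partial E), Valid t P.F → ∀ f : Config E → R,
      ((leaves t P).map fun ℓ => expect p (fun ω => f ω * ℓ.event.indicator 1 ω)).sum =
        expect p (fun ω => f ω * P.event.indicator 1 ω) := by
  induction t with
  | leaf =>
    intro P _ f
    simp [leaves]
  | node e t₀ t₁ ih₀ ih₁ =>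
    intro P hv f
    obtain ⟨he, hv₀, hv₁⟩ := hv
    simp only [leaves, List.map_append, List.sum_append]
    rw [ih₀ (P.extend e false) hv₀ f, ih₁ (P.extend e true) hv₁ f,
      extend_event_false P he, extend_event_true P he]
    unfold expect
    rw [← Finset.sum_add_distrib]
    refine Finset.sum_congr rfl fun ω _ => ?_
    dsimp only
    rw [indicator_inter_one, indicator_inter_one]
    have h := closed_add_open_indicator (R := R) e ω
    linear_combination (weight p ω * f ω * P.event.indicator 1 ω) * h

/-- The expectation partition from the root: `Σ_{ℰ ∈ leaves t root} E[f · 1_ℰ] = E[f]`. -/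
theorem expect_leaves_sum_root (p : E → R) (t : ETree E) (hv : Valid t ∅) (f : Config E → R) :
    ((leaves t root).map fun ℓ => expect p (fun ω => f ω * ℓ.event.indicator 1 ω)).sum =
      expect p f := by
  rw [expect_leaves_sum p t root hv f, root_event]
  simp

end ExpectPartition

/-! ## T-explorations -/

section TExplorationDef

variable {V : Type*} {E : Type*} [DecidableEq E]

/-- A **T-exploration** for the roots `a₁` (light), `a₂` (heavy) and `a₃`: a valid tree whose
T-leaves carve `T = {a₁ ∉ C₂, a₃ ∈ C₂}` out of `Q = {a₁ ∉ C₂}` and determine the heavy cluster as the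
union cluster of an explored seed set. -/
structure TExploration (ends : E → Sym2 V) (a₁ a₂ a₃ : V) where
  /-- the exploration tree -/
  tree : ETree E
  /-- every edge is revealed at most once along each branch -/
  valid : Valid tree ∅
  /-- the T-leaves -/
  isT : Partial E → Bool
  /-- the explored seed set of a leaf -/
  seed : Partial E → Finset V
  /-- on a T-leaf, `T` coincides with `Q` -/
  T_inter : ∀ ℓ ∈ leaves tree root, isT ℓ = true →
    ℓ.event ∩ TEvent ends a₁ a₂ a₃ = ℓ.event ∩ avoidAll ends a₂ {a₁}
  /-- a non-T-leaf misses `T` -/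
  nonT : ∀ ℓ ∈ leaves tree root, isT ℓ = false → ℓ.event ∩ TEvent ends a₁ a₂ a₃ = ∅
  /-- on a T-leaf the heavy cluster is the union cluster of the seed set -/
  determined : ∀ ℓ ∈ leaves tree root, isT ℓ = true → ClusterDetermined ends ℓ a₂ (seed ℓ)

variable {ends : E → Sym2 V} {a₁ a₂ a₃ : V}

/-- The T-leaves of a T-exploration. -/
def TExploration.Tleaves (τ : TExploration ends a₁ a₂ a₃) : List (Partial E) :=
  (leaves τ.tree root).filter τ.isT

omit [DecidableEq E] in
/-- On a leaf with `ClusterDetermined ℓ a₂ S`, the event `{S ↮ a₁}` is `Q = {a₂ ↮ a₁}`. -/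
lemma avoidAllT_iff_of_determined {ℓ : Partial E} {S : Finset V}
    (h : ClusterDetermined ends ℓ a₂ S) {ω : Config E} (hω : ω ∈ ℓ.event) :
    ω ∈ avoidAllT ends S {a₁} ↔ ω ∈ avoidAll ends a₂ {a₁} := by
  have hc := h ω hω
  have ha₂ : a₂ ∈ clusterSet ends ω S := by
    rw [← hc]
    exact mem_cluster_self ends ω a₂
  obtain ⟨s₀, hs₀, hs₀c⟩ := ha₂
  simp only [avoidAllT, avoidAll, Set.mem_setOf_eq, Finset.mem_singleton, forall_eq]
  constructor
  · intro hav h21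
    exact hav s₀ hs₀ (conn_trans hs₀c h21)
  · intro hQ s hs hsx
    have hs' : s ∈ cluster ends ω a₂ := by
      rw [hc]
      exact seed_mem_clusterSet ends ω hs
    exact hQ (conn_trans hs' hsx)

end TExplorationDef

/-! ## The leaf decomposition of `T` -/

section TDecomposition

variable {V : Type*} {E : Type*} [Fintype E] [DecidableEq E] {R : Type*} [CommRing R]
  {ends : E → Sym2 V} {a₁ a₂ a₃ : V}

/-- **Leaf decomposition of `T`**: `E[f · 1_T] = Σ_{T-leaves} P(ℓ) · E[f · 1_Q ∣ ℓ]`. -/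
theorem expect_T_eq_sum (p : E → R) (τ : TExploration ends a₁ a₂ a₃) (f : Config E → R) :
    expect p (fun ω => f ω * (TEvent ends a₁ a₂ a₃).indicator 1 ω) =
      (τ.Tleaves.map fun ℓ => prob p ℓ.event *
        expect (pin p ℓ) (fun ω => f ω * (avoidAll ends a₂ {a₁}).indicator 1 ω)).sum := by
  rw [← expect_leaves_sum_root p τ.tree τ.valid, TExploration.Tleaves, sum_map_filter_eq]
  congr 1
  refine List.map_congr_left fun ℓ hℓ => ?_
  by_cases hT : τ.isT ℓ = true
  · rw [if_pos hT, ← expect_mul_indicator_event]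
    congr 1
    funext ω
    have e := τ.T_inter ℓ hℓ hT
    have key := Set.ext_iff.1 e ω
    simp only [Set.mem_inter_iff] at key
    by_cases hω : ω ∈ ℓ.event
    · by_cases hQ : ω ∈ avoidAll ends a₂ {a₁}
      · have hT' : ω ∈ TEvent ends a₁ a₂ a₃ := (key.2 ⟨hω, hQ⟩).2
        simp [Set.indicator_of_mem hω, Set.indicator_of_mem hQ, Set.indicator_of_mem hT']
      · have hT' : ω ∉ TEvent ends a₁ a₂ a₃ := fun h => hQ (key.1 ⟨hω, h⟩).2
        simp [Set.indicator_of_notMem hQ, Set.indicator_of_notMem hT']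
    · simp [Set.indicator_of_notMem hω]
  · have hT' : τ.isT ℓ = false := by simpa using hT
    rw [if_neg hT]
    have e := τ.nonT ℓ hℓ hT'
    unfold expect
    refine Finset.sum_eq_zero fun ω _ => ?_
    by_cases h1 : ω ∈ ℓ.event
    · by_cases h2 : ω ∈ TEvent ends a₁ a₂ a₃
      · exfalso
        have : ω ∈ ℓ.event ∩ TEvent ends a₁ a₂ a₃ := ⟨h1, h2⟩
        rw [e] at this
        exact this
      · simp [Set.indicator_of_notMem h2]
    · simp [Set.indicator_of_notMem h1]

end TDecomposition

/-! ## The (C1)-slack and the per-leaf quantities -/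

section C1Defs

variable {V : Type*} {E : Type*} [Fintype E] [DecidableEq E] [Fintype V] [DecidableEq V]
  {R : Type*} [Field R] [LinearOrder R] [IsStrictOrderedRing R]

/-- `Φ(ω) := (D_o − D · f_o(U)) · (1_{b ∈ U} − f_b(U))`, `U = C₂` — `D` times p1's `φ χ`. -/
noncomputable def Phi (p : E → R) (ends : E → Sym2 V) (o a₁ a₂ a₃ b : V) (ω : Config E) : R :=
  ((prob p (PDEvent ends a₁ a₂ a₃ ∩ connEvent ends a₁ o) +
      prob p (PDEvent ends a₁ a₂ a₃ ∩ connEvent ends a₂ o)) -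
    prob p (PDEvent ends a₁ a₂ a₃) * delClusterProb p ends a₁ {W | o ∈ W} (cluster ends ω a₂)) *
  (ind b (cluster ends ω a₂) - delClusterProb p ends a₁ {W | b ∈ W} (cluster ends ω a₂))

/-- `leafA ℓ := E[(D_o − D f_o(U)) 1_Q ∣ ℓ]` (`D` times p1's per-path share slack `A(ℓ)`). -/
noncomputable def leafA (p : E → R) (ends : E → Sym2 V) (o a₁ a₂ a₃ : V) (ℓ : Partial E) : R :=
  expect (pin p ℓ) (fun ω =>
    ((prob p (PDEvent ends a₁ a₂ a₃ ∩ connEvent ends a₁ o) +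
        prob p (PDEvent ends a₁ a₂ a₃ ∩ connEvent ends a₂ o)) -
      prob p (PDEvent ends a₁ a₂ a₃) * delClusterProb p ends a₁ {W | o ∈ W} (cluster ends ω a₂)) *
    (avoidAll ends a₂ {a₁}).indicator 1 ω)

/-- `leafB ℓ := E[(1_{b ∈ U} − f_b(U)) 1_Q ∣ ℓ]` (p1's per-path margin `B(ℓ)`). -/
noncomputable def leafB (p : E → R) (ends : E → Sym2 V) (a₁ a₂ b : V) (ℓ : Partial E) : R :=
  expect (pin p ℓ) (fun ω =>
    (ind b (cluster ends ω a₂) - delClusterProb p ends a₁ {W | b ∈ W} (cluster ends ω a₂)) *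
    (avoidAll ends a₂ {a₁}).indicator 1 ω)

/-- `leafQ ℓ := P(Q ∣ ℓ)`. -/
noncomputable def leafQ (p : E → R) (ends : E → Sym2 V) (a₁ a₂ : V) (ℓ : Partial E) : R :=
  prob (pin p ℓ) (avoidAll ends a₂ {a₁})

/-- **`SL1 τ := Σ_{T-leaves} P(ℓ) · leafA ℓ · leafB ℓ / leafQ ℓ`** (`D` times p1's `SL1`; a term with
`P(Q ∣ ℓ) = 0` is `0`). -/
noncomputable def SL1 (p : E → R) {ends : E → Sym2 V} {a₁ a₂ a₃ : V} (o b : V)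
    (τ : TExploration ends a₁ a₂ a₃) : R :=
  (τ.Tleaves.map fun ℓ => prob p ℓ.event * leafA p ends o a₁ a₂ a₃ ℓ * leafB p ends a₁ a₂ b ℓ /
    leafQ p ends a₁ a₂ ℓ).sum

end C1Defs

end ExplorationTree

end Summit.Ventures.PercRepro2
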